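import Literature.NumberTheory.EllipticCurves.BSDSelmerCMPConverseRankOneProofs
import Literature.NumberTheory.EllipticCurves.BSDRankZeroDensity
import Literature.NumberTheory.EllipticCurves.BSDRankZeroDensityProofs
import Literature.NumberTheory.EllipticCurves.BSDAverageRankFiveSelmer
import Literature.NumberTheory.EllipticCurves.IwasawaLeadingTermOddPrime
import Literature.NumberTheory.EllipticCurves.PadicSigmaOddPrime
import Literature.NumberTheory.EllipticCurves.PAdicLFunctionOrderTransferRankOneProofs
import Literature.NumberTheory.EllipticCurves.PAdicBSD
import Literature.NumberTheory.EllipticCurves.CyclotomicIwasawaMainTheoremIrreducible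
import Literature.NumberTheory.EllipticCurves.KatoRankBoundProofs
import Literature.NumberTheory.EllipticCurves.IwasawaSelmerDualProofs
import Literature.NumberTheory.EllipticCurves.IwasawaSelmerModuleFiniteProofs
import HarnessLib

/-!
# Cell bsd-rank2 (TWIN leaf `PAdicBSDRankTwoPositiveProportion`, door D-count): the PER-MEMBER
# door kernel — a `p`-Selmer count `#Sel_p = p²` pins `rank = 2`, kills `Ш[p^∞]`, and (with the
# main conjecture and Schneider's non-degeneracy) gives `ord_{T=0} L_p(E,T) = 2` (theorems only)

Cell-side file (cell bsd-rank2; the kernels K1, K2, K4 of the p2 lane's counting door,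
`HOME/p2/PADIC-R2-G8.md` §3 and `HOME/p2/PadicRank2SketchG8.lean` §1–§4, seat p2 GEN 8, where they
were kernel-checked as a sketch; landed in the tree by seat bsd-rank2-lit GEN 10 for the D-0059 route
`route-BirchSwinnertonDyer-CountingDoorF2AtThree`, whose support item `DoorKernelAtThree` is the
`p = 3` instance `doorKernel_at_three` below read under the route's fact pack
`PublishedInputsAtThree`). Companion of `F2DensityAlgebra.lean` (the bookkeeping kernel K3).
Everything is PROVED from tree theorems; the published inputs that are still NAMED FACTS in the tree
enter as explicit hypotheses, by name: `Schneider1985_order_charGenerator_odd` (Schneider 1985 /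
Perrin-Riou / BMS Thm 1.7 at odd `p`), `mazur_tate_sigma_exists_odd` (Mazur–Tate `σ` at odd good
ordinary `p`), `even_selmerRank_sub_torsionRank_iff` (Dokchitser–Dokchitser `p`-parity in counting
form), `skinner_urban_main_conjecture` (Skinner–Urban 2014 Thm 3.29 / 3.6.9) or
`burungale_castella_skinner_charIdeal_eq_padicLFunction` (B–C–S, `p ≥ 5`). No new definition, no
named fact, no instance.

* K1 `rank_eq_two_and_sha_eq_bot_of_card_selmerGroup` (any number field `K`): `#Sel_p(E/K) = p²`,
  `rank E(K) ≥ 2`, `#E(K)[p] = 1` ⟹ `rank E(K) = 2` and `Ш(E/K)[p^∞] = 0` — pure counting on the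
  tree theorem `#Sel_p = p^rank · #E(K)[p] · #Ш[p]` (`natCard_selmerGroup_eq`) and "a `p`-primary
  group with no `p`-torsion is trivial" (`primaryComponent_sha_eq_bot_of_inf_torsionBy_eq_bot`);
  over `ℚ`: `…_rat`, and `…_of_irreducible` (`E[p]` irreducible ⟹ `E(ℚ)[p] = 0`).
* K2 `card_selmerGroup_bounds_of_rootNumber` (modulo D–D parity): with `rank ≥ 2` and
  `E(ℚ)[p] = 0`, root number `−1` forces `#Sel_p ≥ p³`, root number `+1` with `#Sel_p ≠ p²` forces
  `#Sel_p ≥ p⁴` — the three member-wise lower bounds fed to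
  `hasPositiveLowerDensityOn_of_memberwise_bounds` (`F2DensityAlgebra.lean`) with
  `(c_lo, c_mid, c_hi) = (p², p³, p⁴)`.
* K4 `order_eq_two_of_count` (modulo Schneider 1985 at odd `p` + MT `σ`): a counted member with the
  main conjecture IN GENERATOR FORM (`char X = (g)`, `ι g = p^k · L`) and Schneider's conjecture for
  the canonical height has `rank = 2`, `Ш[p^∞] = 0`, `ord_T L = 2`; `…_SU` (the door at `p ≥ 3` via
  Skinner–Urban, auxiliary multiplicative prime `ℓ` with `p ∤ v_ℓ(Δ_min)`) and `…_BCS` (`p ≥ 5`, no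
  auxiliary prime) supply the generator form from the tree's named main-conjecture facts.
* `doorKernel_at_three` — the route's support item `DoorKernelAtThree` with its antecedent
  `PublishedInputsAtThree` unpacked into the three named facts it inlines (the cyclotomic datum
  `κ, γ` and the Iwasawa module `D` are supplied by the tree theorems
  `exists_isCyclotomic_isTopGenerator_isCyclotomicVariable_holds`, `nonempty_selmerDualData_holds`,
  `SelmerDualData.module_finite_holds`): a globally minimal elliptic `W/ℚ`, good ordinary at `3`,
  `ρ̄₃` irreducible, with an auxiliary prime `ℓ ≠ 3` of multiplicative reduction and
  `3 ∤ v_ℓ(Δ_min)`, Schneider at `3`, `#Sel₃ = 9`, `rank ≥ 2` has `rank = 2`, `Ш[3^∞] = 0` and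
  `ord_T L₃(f, α; T) = 2` for every weight-two newform `f` of `W`.

PARTITION: none — r_an ≥ 2, summit axis S0; TWIN (D-0056): n/a. B1 honesty: no declaration here
mentions the analytic rank or the complex `L`-function; the only `L`-object is the cyclotomic
`p`-adic `L`-function `padicLFunction f α`, whose order is read off the ALGEBRAIC side through the
main conjecture (TWIN currency); S0 is not touched.

References: `HOME/p2/PADIC-R2-G8.md` §3 (door D-count), `HOME/p2/PadicRank2SketchG8.lean` (K1–K4);
Skinner–Urban, Invent. Math. 195 (2014) Thm 3.29 [SkinnerUrban2014]; P. Schneider, Invent. Math. 79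
(1985) [Schneider1985]; B. Perrin-Riou, Invent. Math. 1984 [PerrinRiou1984]; R. Greenberg, LNM 1716
(1999) [Greenberg1999LNM]; T. and V. Dokchitser, Ann. Math. 172 (2010) [DokchitserDokchitserAnnals2010];
Burungale–Castella–Skinner 2024 [BurungaleCastellaSkinner2024].
-/

noncomputable section

open scoped Classical
open WeierstrassCurve Literature.NumberTheory.EllipticCurves
  Literature.NumberTheory.EllipticCurves.ModularForms CongruenceSubgroup

namespace Summit.BirchSwinnertonDyer.Rank2

/-! ### K1 — the Selmer count pins the rank and kills `Ш[p^∞]` -/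

section K1

variable {K : Type} [Field K] [NumberField K] (W : WeierstrassCurve K) [W.IsElliptic]
  (p : ℕ) [Fact p.Prime]

/-- **K1** (any number field `K`). `#Sel_p(E/K) = p²`, `rank E(K) ≥ 2`, `#E(K)[p] = 1` ⟹
`rank E(K) = 2` and `Ш(E/K)[p^∞] = 0`: from `#Sel_p = p^rank · #E(K)[p] · #Ш[p]` the factor
`p^rank` is at most `p²`, hence the rank is `2` and `#Ш[p] = 1`, and a `p`-primary group with
trivial `p`-torsion is trivial. [folklore] -/
theorem rank_eq_two_and_sha_eq_bot_of_card_selmerGroup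
    (hSel : Nat.card (W.selmerGroup p) = p ^ 2) (h2 : 2 ≤ W.mordellWeilRank)
    (ht : Nat.card (AddSubgroup.torsionBy W.toAffine.Point (p : ℤ)) = 1) :
    W.mordellWeilRank = 2 ∧ AddCommGroup.primaryComponent W.sha p = ⊥ := by
  have hp : p.Prime := Fact.out
  have hcard := W.natCard_selmerGroup_eq hp.ne_zero
  rw [hSel, ht, mul_one] at hcard
  obtain ⟨c, hc⟩ :
      ∃ c, Nat.card (W.sha ⊓ AddSubgroup.torsionBy W.galH1 p : AddSubgroup W.galH1) = c :=
    ⟨_, rfl⟩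
  rw [hc] at hcard
  have hc0 : c ≠ 0 := by
    intro h0
    rw [h0, mul_zero] at hcard
    exact pow_ne_zero 2 hp.ne_zero hcard
  have hle : p ^ W.mordellWeilRank ≤ p ^ 2 := by
    calc p ^ W.mordellWeilRank = p ^ W.mordellWeilRank * 1 := (mul_one _).symm
      _ ≤ p ^ W.mordellWeilRank * c := Nat.mul_le_mul_left _ (Nat.one_le_iff_ne_zero.mpr hc0)
      _ = p ^ 2 := hcard.symm
  have hr2 : W.mordellWeilRank ≤ 2 := (pow_le_pow_iff_right₀ hp.one_lt).mp hle
  have hr : W.mordellWeilRank = 2 := le_antisymm hr2 h2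
  refine ⟨hr, ?_⟩
  rw [hr] at hcard
  have hc1 : c = 1 := by
    have h : p ^ 2 * c = p ^ 2 * 1 := by rw [mul_one]; exact hcard.symm
    exact Nat.eq_of_mul_eq_mul_left (pow_pos hp.pos 2) h
  rw [← hc] at hc1
  exact primaryComponent_sha_eq_bot_of_inf_torsionBy_eq_bot W p (AddSubgroup.eq_bot_of_card_eq _ hc1)

end K1

section K1Q

variable (W : WeierstrassCurve ℚ) [W.IsElliptic] (p : ℕ) [Fact p.Prime]

/-- K1 over `ℚ`, with the hypothesis `#E(ℚ)[p] = 1` stated with `ℚ`'s own instances (`convert`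
bridges the decidable-equality instance on `E(ℚ)` between the general-`K` lemma and `ℚ`). [folklore] -/
theorem rank_eq_two_and_sha_eq_bot_of_card_selmerGroup_rat
    (hSel : Nat.card (W.selmerGroup p) = p ^ 2) (h2 : 2 ≤ W.mordellWeilRank)
    (ht : Nat.card (AddSubgroup.torsionBy W.toAffine.Point (p : ℤ)) = 1) :
    W.mordellWeilRank = 2 ∧ AddCommGroup.primaryComponent W.sha p = ⊥ :=
  rank_eq_two_and_sha_eq_bot_of_card_selmerGroup W p hSel h2 (by convert ht)

/-- K1 over `ℚ` with `E[p]` irreducible in place of `E(ℚ)[p] = 0` (tree theorem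
`natCard_torsionBy_eq_one_of_hasIrreducibleModPGaloisRep`: an irreducible `E[p]` has no rational
line, so no rational point of order `p`). [folklore] -/
theorem rank_eq_two_and_sha_eq_bot_of_card_selmerGroup_of_irreducible
    (hSel : Nat.card (W.selmerGroup p) = p ^ 2) (h2 : 2 ≤ W.mordellWeilRank)
    (hirr : W.HasIrreducibleModPGaloisRep p) :
    W.mordellWeilRank = 2 ∧ AddCommGroup.primaryComponent W.sha p = ⊥ :=
  rank_eq_two_and_sha_eq_bot_of_card_selmerGroup W p hSel h2
    (by convert natCard_torsionBy_eq_one_of_hasIrreducibleModPGaloisRep W p hirr)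

end K1Q

/-! ### K2 — parity (Dokchitser–Dokchitser) splits the Selmer sizes by root number -/

section K2

variable (W : WeierstrassCurve ℚ) [W.IsElliptic] (p : ℕ) [Fact p.Prime]

/-- **K2** (modulo the named fact `even_selmerRank_sub_torsionRank_iff`, Dokchitser–Dokchitser
`p`-parity in counting form). With `rank E(ℚ) ≥ 2` and `#E(ℚ)[p] = 1`, write `#Sel_p = p^s`: then
`s ≥ 2`, `s` is even iff the root number is `+1`; hence root number `−1` forces `#Sel_p ≥ p³`, and
root number `+1` with `#Sel_p ≠ p²` forces `#Sel_p ≥ p⁴`. [cite: DokchitserDokchitserAnnals2010, Thm 1.4] -/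
theorem card_selmerGroup_bounds_of_rootNumber (hDD : even_selmerRank_sub_torsionRank_iff)
    (h2 : 2 ≤ W.mordellWeilRank)
    (ht : Nat.card (AddSubgroup.torsionBy W.toAffine.Point (p : ℤ)) = 1) :
    (W.rootNumber = -1 → p ^ 3 ≤ Nat.card (W.selmerGroup p)) ∧
      (W.rootNumber = 1 → Nat.card (W.selmerGroup p) ≠ p ^ 2 →
        p ^ 4 ≤ Nat.card (W.selmerGroup p)) := by
  have hp : p.Prime := Fact.out
  obtain ⟨s, hs⟩ := exists_natCard_selmerGroup_eq_pow W p
  have ht' : Nat.card (AddSubgroup.torsionBy W.toAffine.Point (p : ℤ)) = p ^ 0 := by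
    rw [pow_zero]; exact ht
  have hpar : Even s ↔ W.rootNumber = 1 := by simpa using hDD W p s 0 hs ht'
  have hrk : p ^ W.mordellWeilRank * 1 ≤ p ^ s := by
    rw [← hs]
    convert W.pow_mordellWeilRank_mul_card_torsionBy_le_card_selmerGroup hp.ne_zero using 2
    convert ht.symm
  rw [mul_one] at hrk
  have hs2 : 2 ≤ s := le_trans h2 ((pow_le_pow_iff_right₀ hp.one_lt).mp hrk)
  refine ⟨fun hw ↦ ?_, fun hw hne ↦ ?_⟩
  · -- root number `-1`: `s` is odd and `≥ 2`, so `s ≥ 3`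
    have hodd : ¬ Even s := by
      intro he
      have h1 := hpar.mp he
      rw [hw] at h1
      norm_num at h1
    have hs3 : 3 ≤ s := by
      rcases Nat.even_or_odd s with he | ho
      · exact absurd he hodd
      · obtain ⟨k, hk⟩ := ho; omega
    rw [hs]
    exact pow_le_pow_right₀ hp.one_le hs3
  · -- root number `+1`: `s` is even, `s ≥ 2`, `s ≠ 2`, so `s ≥ 4`
    have he : Even s := hpar.mpr hw
    have hs2' : s ≠ 2 := fun h ↦ hne (by rw [hs, h])
    have hs4 : 4 ≤ s := by obtain ⟨k, hk⟩ := he; omega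
    rw [hs]
    exact pow_le_pow_right₀ hp.one_le hs4

end K2

/-! ### K4 — the `p`-adic door on a counted member: `ord_{T=0} L_p(E,T) = 2 = rank E(ℚ)` -/

section K4

variable (W : WeierstrassCurve ℚ) [W.IsElliptic] [W.IsGloballyMinimal] (p : ℕ) [Fact p.Prime]

/-- **K4 (per member, generator form).** Modulo Schneider 1985 / Perrin-Riou at odd `p`
(`Schneider1985_order_charGenerator_odd`) and the Mazur–Tate `σ` (`mazur_tate_sigma_exists_odd`,
which makes the canonical height datum exist): a counted member (`#Sel_p = p²`, `rank ≥ 2`,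
`#E(ℚ)[p] = 1`) at an odd good ordinary `p`, whose Iwasawa module is torsion with `char X = (g)` and
`ι g = p^k · L`, and whose canonical `p`-adic height is non-degenerate (Schneider's conjecture), has
`rank = 2`, `Ш[p^∞] = 0` and `ord_T L = 2`: K1 gives rank `2` and `Ш[p^∞] = 0` (so finite), the
order formula gives `ord_T g = rank = 2`, and `ι` preserves the order.
[cite: Schneider1985, Thm 2′ (p. 342)] [cite: PerrinRiou1984, §3.4] -/
theorem order_eq_two_of_count (h85 : Schneider1985_order_charGenerator_odd)
    (hex : mazur_tate_sigma_exists_odd)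
    (hp2 : p ≠ 2) (hgood : W.HasGoodReductionAtPrime p) (hord : ¬ (p : ℤ) ∣ W.frobeniusTrace p)
    {κ : ZpExtension ℚ p} {γ : Field.absoluteGaloisGroup ℚ}
    (hκ : κ.IsCyclotomic) (hγ : κ.IsTopGenerator γ) (hγ' : IsCyclotomicVariable p γ)
    (D : W.SelmerDualData κ γ) [Module.Finite (IwasawaAlgebra p) D.X] (hX : D.IsTorsion)
    {g : IwasawaAlgebra p} (hchar : D.charIdeal = Ideal.span {g})
    {k : ℤ} {L : PowerSeries ℚ_[p]}
    (hιg : iwasawaToPowerSeries p g = PowerSeries.C ((p : ℚ_[p]) ^ k) * L)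
    (hR : ∀ Dh : PAdicHeightData W p, Dh.IsCanonical → SchneiderConjecture Dh)
    (hSel : Nat.card (W.selmerGroup p) = p ^ 2) (h2 : 2 ≤ W.mordellWeilRank)
    (ht : Nat.card (AddSubgroup.torsionBy W.toAffine.Point (p : ℤ)) = 1) :
    W.mordellWeilRank = 2 ∧ AddCommGroup.primaryComponent W.sha p = ⊥ ∧ L.order = 2 := by
  obtain ⟨hr, hsha⟩ := rank_eq_two_and_sha_eq_bot_of_card_selmerGroup_rat W p hSel h2 ht
  obtain ⟨Dh, hDh, -, hiff⟩ := h85.exists_canonical hex W p hp2 hgood hord hκ hγ hγ' D hX hchar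
  have hfin : Finite (AddCommGroup.primaryComponent W.sha p) := by
    rw [hsha]; infer_instance
  have hg2 : g.order = ((2 : ℕ) : ℕ∞) := by
    have h := hiff.mpr ⟨hR Dh hDh, hfin⟩
    rwa [hr] at h
  refine ⟨hr, hsha, ?_⟩
  rw [order_eq_order_of_iwasawaToPowerSeries_eq p hιg, hg2]
  rfl

/-- **K4 at `p ≥ 3` via Skinner–Urban** (modulo the named facts `Schneider1985_order_charGenerator_odd`,
`mazur_tate_sigma_exists_odd` and `skinner_urban_main_conjecture W p`). On a counted member with
`E[p]` irreducible, `p ≥ 3` good ordinary, an auxiliary multiplicative prime `ℓ ≠ p` with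
`p ∤ v_ℓ(Δ_min)`, and Schneider's conjecture for the canonical `p`-adic height:
`rank E(ℚ) = 2`, `Ш(E)[p^∞] = 0`, and `ord_{T=0} L_p(f, α; T) = 2` for the newform `f` of `E`.
[cite: SkinnerUrban2014, Thm 3.29] -/
theorem order_eq_two_of_count_SU (h85 : Schneider1985_order_charGenerator_odd)
    (hex : mazur_tate_sigma_exists_odd)
    {κ : ZpExtension ℚ p} {γ : Field.absoluteGaloisGroup ℚ} {N : ℕ} [NeZero N]
    {f : CuspForm (Gamma0 N) 2}
    (hSU : skinner_urban_main_conjecture W p (κ := κ) (γ := γ) (f := f))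
    (hp : 3 ≤ p) (hgood : W.HasGoodReductionAtPrime p) (hord : ¬ (p : ℤ) ∣ W.frobeniusTrace p)
    (hirr : W.HasIrreducibleModPGaloisRep p)
    (haux : ∃ ℓ : ℕ, ∃ _ : Fact ℓ.Prime, ℓ ≠ p ∧ W.HasMultiplicativeReductionAtPrime ℓ ∧
      ¬ p ∣ padicValInt ℓ W.minimalDiscriminantInt)
    (hκ : κ.IsCyclotomic) (hγ : κ.IsTopGenerator γ) (hγ' : IsCyclotomicVariable p γ)
    (hf : IsNewformOf W f) (D : W.SelmerDualData κ γ) [Module.Finite (IwasawaAlgebra p) D.X]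
    (hR : ∀ Dh : PAdicHeightData W p, Dh.IsCanonical → SchneiderConjecture Dh)
    (hSel : Nat.card (W.selmerGroup p) = p ^ 2) (h2 : 2 ≤ W.mordellWeilRank) :
    W.mordellWeilRank = 2 ∧ AddCommGroup.primaryComponent W.sha p = ⊥ ∧
      (padicLFunction f (unitRoot W p : ℚ_[p])).order = 2 := by
  obtain ⟨hX, ⟨g, k, hchar, hιg⟩, -⟩ := hSU hp hgood hord hirr haux hκ hγ hγ' hf D
  have ht : Nat.card (AddSubgroup.torsionBy W.toAffine.Point (p : ℤ)) = 1 := by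
    convert natCard_torsionBy_eq_one_of_hasIrreducibleModPGaloisRep W p hirr
  exact order_eq_two_of_count W p h85 hex (by omega) hgood hord hκ hγ hγ' D hX hchar hιg hR hSel h2 ht

/-- **K4 at `p ≥ 5` via Burungale–Castella–Skinner** (no auxiliary prime; modulo the named facts
`Schneider1985_order_charGenerator_odd`, `mazur_tate_sigma_exists_odd`,
`burungale_castella_skinner_charIdeal_eq_padicLFunction`). [cite: BurungaleCastellaSkinner2024, Thm 1.2] -/
theorem order_eq_two_of_count_BCS (h85 : Schneider1985_order_charGenerator_odd)
    (hex : mazur_tate_sigma_exists_odd)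
    (hMC : burungale_castella_skinner_charIdeal_eq_padicLFunction)
    (hp : 5 ≤ p) (hgood : W.HasGoodReductionAtPrime p) (hord : ¬ (p : ℤ) ∣ W.frobeniusTrace p)
    (hirr : W.HasIrreducibleModPGaloisRep p)
    {κ : ZpExtension ℚ p} {γ : Field.absoluteGaloisGroup ℚ}
    (hκ : κ.IsCyclotomic) (hγ : κ.IsTopGenerator γ) (hγ' : IsCyclotomicVariable p γ)
    {N : ℕ} [NeZero N] {f : CuspForm (Gamma0 N) 2} (hf : IsNewformOf W f)
    (D : W.SelmerDualData κ γ) [Module.Finite (IwasawaAlgebra p) D.X]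
    (hR : ∀ Dh : PAdicHeightData W p, Dh.IsCanonical → SchneiderConjecture Dh)
    (hSel : Nat.card (W.selmerGroup p) = p ^ 2) (h2 : 2 ≤ W.mordellWeilRank) :
    W.mordellWeilRank = 2 ∧ AddCommGroup.primaryComponent W.sha p = ⊥ ∧
      (padicLFunction f (unitRoot W p : ℚ_[p])).order = 2 := by
  obtain ⟨hX, g, k, hchar, hιg⟩ := hMC W p κ γ f hp hgood hord hirr hκ hγ hγ' hf D
  have ht : Nat.card (AddSubgroup.torsionBy W.toAffine.Point (p : ℤ)) = 1 := by
    convert natCard_torsionBy_eq_one_of_hasIrreducibleModPGaloisRep W p hirr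
  exact order_eq_two_of_count W p h85 hex (by omega) hgood hord hκ hγ hγ' D hX hchar hιg hR hSel h2 ht

end K4

/-! ### The route's support item `DoorKernelAtThree`, with `PublishedInputsAtThree` unpacked -/

/-- **The per-member door kernel at `p = 3`** (the body of the route item `DoorKernelAtThree` of
`route-BirchSwinnertonDyer-CountingDoorF2AtThree` after its antecedent `PublishedInputsAtThree`,
whose conjuncts — Schneider 1985 at odd `p`, Mazur–Tate `σ` at odd `p`, and Skinner–Urban's main
conjecture at `p = 3` for every globally minimal `W` and every `(κ, γ, f)` — are taken here by name).
A globally minimal elliptic `W/ℚ`, good ordinary at `3`, with `ρ̄₃` irreducible, an auxiliary prime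
`ℓ ≠ 3` of multiplicative reduction with `3 ∤ v_ℓ(Δ_min)`, Schneider's conjecture at `3`,
`#Sel₃(W) = 9` and `rank W(ℚ) ≥ 2`, has `rank W(ℚ) = 2`, `Ш(W)[3^∞] = 0` and
`ord_{T=0} L₃(f, α; T) = 2` for every weight-two newform `f` of `W`; the cyclotomic datum and the
Iwasawa module are the tree's (`exists_isCyclotomic_isTopGenerator_isCyclotomicVariable_holds`,
`nonempty_selmerDualData_holds`, `SelmerDualData.module_finite_holds`). [cite: SkinnerUrban2014, Thm 3.29] -/
theorem doorKernel_at_three (h85 : Schneider1985_order_charGenerator_odd)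
    (hex : mazur_tate_sigma_exists_odd)
    (hSU : ∀ (W : WeierstrassCurve ℚ) [W.IsElliptic] [W.IsGloballyMinimal]
      (κ : ZpExtension ℚ 3) (γ : Field.absoluteGaloisGroup ℚ) {N : ℕ} [NeZero N]
      (f : CuspForm (Gamma0 N) 2), skinner_urban_main_conjecture W 3 (κ := κ) (γ := γ) (f := f))
    (W : WeierstrassCurve ℚ) [W.IsElliptic] [W.IsGloballyMinimal]
    (hord : IsOrdinaryAt W 3) (hirr : W.HasIrreducibleModPGaloisRep 3)
    (haux : ∃ ℓ : ℕ, ∃ _ : Fact ℓ.Prime, ℓ ≠ 3 ∧ W.HasMultiplicativeReductionAtPrime ℓ ∧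
      ¬ 3 ∣ padicValInt ℓ W.minimalDiscriminantInt)
    (hR : ∀ Dh : PAdicHeightData W 3, Dh.IsCanonical → SchneiderConjecture Dh)
    (hSel : Nat.card (W.selmerGroup 3) = 3 ^ 2) (h2 : 2 ≤ W.mordellWeilRank) :
    W.mordellWeilRank = 2 ∧ AddCommGroup.primaryComponent W.sha 3 = ⊥ ∧
      ∀ ⦃N : ℕ⦄ [NeZero N] (f : CuspForm (Gamma0 N) 2), IsNewformOf W f →
        (padicLFunction f (unitRoot W 3 : ℚ_[3])).order = 2 := by
  obtain ⟨hr, hsha⟩ := rank_eq_two_and_sha_eq_bot_of_card_selmerGroup_of_irreducible W 3 hSel h2 hirr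
  refine ⟨hr, hsha, fun N _ f hf ↦ ?_⟩
  obtain ⟨κ, hκ, γ, hγ, hγ'⟩ := exists_isCyclotomic_isTopGenerator_isCyclotomicVariable_holds 3
  obtain ⟨D⟩ := W.nonempty_selmerDualData_holds κ γ hγ
  haveI : Module.Finite (IwasawaAlgebra 3) D.X := D.module_finite_holds hγ
  exact (order_eq_two_of_count_SU W 3 h85 hex (hSU W κ γ f) le_rfl hord.1 hord.2 hirr haux hκ hγ hγ'
    hf D hR hSel h2).2.2

end Summit.BirchSwinnertonDyer.Rank2

end
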